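import Mathlib
import Summits.Ventures.PercRepro2.Defs
import Summits.Ventures.PercRepro2.Harris
import Summits.Ventures.PercRepro2.Graph
import Summits.Ventures.PercRepro2.Events
import Summits.Ventures.PercRepro2.THRefutation
import Summits.Ventures.PercRepro2.THExtension
import Summits.Ventures.PercRepro2.THLoops

/-!
# Transport of the three-event form along edge contractions, loop edges, and the refutation of
(T_h) on every graph containing the 7-vertex witness as a rooted minor (blind cell PercRepro2, mine-a g49)

A further transport lemma for `tForm` (`THExtension`): **contraction** — if the edges of a
configuration `ωF` have weight `1` and `q : V → V'` identifies exactly the `ωF`-connected vertices,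
then for every configuration `ω ≥ ωF` the cluster of `q x` in the pushed-forward graph `pushEnds q ends`
is the image `q '' C_x` (`cluster_push`), the clusters are `q`-saturated, and every probability of a
cluster event of the lifted family `liftFamF q 𝓤` equals that of `𝓤` (`prob_contract`,
`tForm_contract`).  After a contraction the contracted edges are loops, invisible to the form
(`THLoops.tForm_eq_of_loops`).  Composed with `THExtension.tForm_extend`:
**(T_h) fails on every finite graph containing `G₆` as a rooted minor** — contract a set of edges with
`q`-connected fibres, find `G₆` as a subgraph of the result (`not_t_of_minor`).  No instance, no notation.
-/

namespace Summit.Ventures.PercRepro2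

namespace THMinor

open Finset THExtension THLoops

section Contraction

variable {V V' : Type*} {E : Type*}

/-- The edge map pushed forward along a (not necessarily injective) vertex map. -/
def pushEnds (q : V → V') (ends : E → Sym2 V) : E → Sym2 V' := fun e => (ends e).map q

/-- A family of vertex sets lifted along a vertex map. -/
def liftFamF (q : V → V') (𝓤 : Set (Set V)) : Set (Set V') := {S' | q ⁻¹' S' ∈ 𝓤}

/-- Lifting preserves up-sets. -/
lemma isUpperSet_liftFamF (q : V → V') {𝓤 : Set (Set V)} (h : IsUpperSet 𝓤) :
    IsUpperSet (liftFamF q 𝓤) :=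
  fun _ _ hle hS => h (Set.preimage_mono hle) hS

/-- The lift of a hit family `{T | x ∈ T}` is the hit family of `q x`. -/
lemma liftFamF_hit (q : V → V') (x : V) :
    liftFamF q {T : Set V | x ∈ T} = {T : Set V' | q x ∈ T} := by
  ext S'; simp [liftFamF]

/-- Open adjacency in the pushed-forward graph lifts, up to the fibres of `q`: an open edge
`q a — w` comes from an open edge `a' — b` with `q a' = q a`, `w = q b`. -/
lemma openAdj_push (q : V → V') (ends : E → Sym2 V) (ω : Config E) (a : V) (w : V')
    (h : OpenAdj (pushEnds q ends) ω (q a) w) :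
    ∃ a' b, q a' = q a ∧ w = q b ∧ OpenAdj ends ω a' b := by
  obtain ⟨e, he, hends⟩ := h
  induction hab : ends e using Sym2.ind with
  | h x y =>
    simp only [pushEnds, hab, Sym2.map_mk, Sym2.eq_iff] at hends
    rcases hends with ⟨h1, h2⟩ | ⟨h1, h2⟩
    · exact ⟨x, y, h1, h2.symm, e, he, hab⟩
    · exact ⟨y, x, h2, h1.symm, e, he, by rw [hab, Sym2.eq_swap]⟩

/-- Open adjacency pushes forward. -/
lemma openAdj_push_of (q : V → V') (ends : E → Sym2 V) (ω : Config E) {a b : V}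
    (h : OpenAdj ends ω a b) : OpenAdj (pushEnds q ends) ω (q a) (q b) := by
  obtain ⟨e, he, hends⟩ := h
  exact ⟨e, he, by simp [pushEnds, hends, Sym2.map_mk]⟩

variable (ends : E → Sym2 V) (q : V → V') (ωF : Config E)

/-- Vertices with the same image are connected in every configuration above `ωF`
(`hq`: `q` identifies exactly the `ωF`-connected vertices). -/
lemma conn_of_eq_push (hq : ∀ a b, q a = q b ↔ Conn ends ωF a b) {ω : Config E} (hω : ωF ≤ ω)
    {a b : V} (h : q a = q b) : Conn ends ω a b :=
  conn_mono hω ((hq a b).1 h)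

/-- **The cluster of `q x` in the contracted graph is the image of the cluster of `x`**, for every
configuration in which the contracted edges are open. -/
theorem cluster_push (hq : ∀ a b, q a = q b ↔ Conn ends ωF a b) {ω : Config E} (hω : ωF ≤ ω)
    (x : V) :
    cluster (pushEnds q ends) ω (q x) = q '' cluster ends ω x := by
  apply Set.Subset.antisymm
  · intro w hw
    refine mem_of_conn_of_closed (ends := pushEnds q ends) (ω := ω) (S := q '' cluster ends ω x)
      ?_ ⟨x, mem_cluster_self ends ω x, rfl⟩ hw
    rintro _ ⟨u, hu, rfl⟩ w' hadj
    obtain ⟨-, hadj'⟩ := openGraph_adj.1 hadj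
    obtain ⟨a', b, hqa, rfl, hab⟩ := openAdj_push q ends ω u w' hadj'
    refine ⟨b, ?_, rfl⟩
    rw [mem_cluster] at hu ⊢
    exact conn_trans (conn_trans hu (conn_of_eq_push ends q ωF hq hω hqa.symm))
      (conn_of_openAdj hab)
  · rintro _ ⟨u, hu, rfl⟩
    rw [mem_cluster] at hu ⊢
    unfold Conn at hu ⊢
    rw [SimpleGraph.reachable_iff_reflTransGen] at hu ⊢
    induction hu with
    | refl => exact Relation.ReflTransGen.refl
    | @tail y z _ hyz ih =>
      obtain ⟨-, hadj⟩ := openGraph_adj.1 hyz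
      by_cases heq : q y = q z
      · rw [← heq]; exact ih
      · exact Relation.ReflTransGen.tail ih
          (openGraph_adj.2 ⟨heq, openAdj_push_of q ends ω hadj⟩)

/-- Clusters above `ωF` are `q`-saturated. -/
lemma preimage_image_cluster (hq : ∀ a b, q a = q b ↔ Conn ends ωF a b) {ω : Config E}
    (hω : ωF ≤ ω) (x : V) :
    q ⁻¹' (q '' cluster ends ω x) = cluster ends ω x := by
  ext a
  constructor
  · rintro ⟨b, hb, hqb⟩
    rw [mem_cluster] at hb ⊢
    exact conn_trans hb (conn_of_eq_push ends q ωF hq hω hqb)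
  · intro ha
    exact ⟨a, ha, rfl⟩

/-- Above `ωF`, the cluster event of a lifted family is the cluster event of the family. -/
theorem mem_clusterInEvent_push (hq : ∀ a b, q a = q b ↔ Conn ends ωF a b) {ω : Config E}
    (hω : ωF ≤ ω) (x : V) (𝓤 : Set (Set V)) :
    ω ∈ clusterInEvent (pushEnds q ends) (q x) (liftFamF q 𝓤) ↔ ω ∈ clusterInEvent ends x 𝓤 := by
  rw [mem_clusterInEvent, mem_clusterInEvent, cluster_push ends q ωF hq hω]
  show q ⁻¹' (q '' cluster ends ω x) ∈ 𝓤 ↔ _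
  rw [preimage_image_cluster ends q ωF hq hω]

variable [Fintype E] {R : Type*} [CommRing R]

/-- A configuration not above `ωF` has weight `0` when the edges of `ωF` have weight `1`. -/
lemma weight_eq_zero_of_not_le {p : E → R} (hp : ∀ e, ωF e = true → p e = 1) {ω : Config E}
    (h : ¬ ωF ≤ ω) : weight p ω = 0 := by
  obtain ⟨e, hF, hω⟩ : ∃ e, ωF e = true ∧ ω e = false := by
    by_contra hall
    apply h
    intro e
    cases hF : ωF e with
    | false => exact Bool.false_le _
    | true =>
      cases hω : ω e with
      | false => exact absurd ⟨e, hF, hω⟩ hall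
      | true => exact le_rfl
  unfold weight
  refine prod_eq_zero (mem_univ e) ?_
  rw [hp e hF, hω]
  simp

variable [DecidableEq E]

/-- **Probabilities only see the configurations above `ωF`** when its edges have weight `1`. -/
theorem prob_contract {p : E → R} (hp : ∀ e, ωF e = true → p e = 1) {A A' : Set (Config E)}
    (h : ∀ ω, ωF ≤ ω → (ω ∈ A' ↔ ω ∈ A)) : prob p A' = prob p A := by
  classical
  unfold prob
  refine sum_congr rfl fun ω _ => ?_
  by_cases hω : ωF ≤ ω
  · simp only [Set.indicator_apply, h ω hω]
  · simp [Set.indicator_apply, weight_eq_zero_of_not_le ωF hp hω]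

/-- **The form is invariant under contraction** of the edges of `ωF` (weight `1`), with the families
lifted along `q`. -/
theorem tForm_contract (hq : ∀ a b, q a = q b ↔ Conn ends ωF a b) {p : E → R}
    (hp : ∀ e, ωF e = true → p e = 1) (s x : V) (𝓤 𝓥 : Set (Set V)) :
    tForm (pushEnds q ends) p (q s) (q x) (liftFamF q 𝓤) (liftFamF q 𝓥) =
      tForm ends p s x 𝓤 𝓥 := by
  unfold tForm
  rw [← liftFamF_hit q x]
  have hQ := fun ω (hω : ωF ≤ ω) => mem_clusterInEvent_push ends q ωF hq hω s {T : Set V | x ∈ T}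
  have hU := fun ω (hω : ωF ≤ ω) => mem_clusterInEvent_push ends q ωF hq hω s 𝓤
  have hV := fun ω (hω : ωF ≤ ω) => mem_clusterInEvent_push ends q ωF hq hω s 𝓥
  set Q' := clusterInEvent (pushEnds q ends) (q s) (liftFamF q {T : Set V | x ∈ T}) with hQ'
  set U' := clusterInEvent (pushEnds q ends) (q s) (liftFamF q 𝓤) with hU'
  set e' := clusterInEvent (pushEnds q ends) (q s) (liftFamF q 𝓥) with he'
  set Q := clusterInEvent ends s {T : Set V | x ∈ T} with hQ0
  set U := clusterInEvent ends s 𝓤 with hU0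
  set e := clusterInEvent ends s 𝓥 with he0
  have e1 : prob p (Q' ∩ U' ∩ e') = prob p (Q ∩ U ∩ e) :=
    prob_contract ωF hp fun ω hω => by simp only [Set.mem_inter_iff, hQ ω hω, hU ω hω, hV ω hω]
  have e2 : prob p Q' = prob p Q := prob_contract ωF hp hQ
  have e3 : prob p (U' ∩ e') = prob p (U ∩ e) :=
    prob_contract ωF hp fun ω hω => by simp only [Set.mem_inter_iff, hU ω hω, hV ω hω]
  have e4 : prob p (Q' ∩ U') = prob p (Q ∩ U) :=
    prob_contract ωF hp fun ω hω => by simp only [Set.mem_inter_iff, hQ ω hω, hU ω hω]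
  have e5 : prob p e' = prob p e := prob_contract ωF hp hV
  have e6 : prob p (Q' ∩ e') = prob p (Q ∩ e) :=
    prob_contract ωF hp fun ω hω => by simp only [Set.mem_inter_iff, hQ ω hω, hV ω hω]
  have e7 : prob p U' = prob p U := prob_contract ωF hp hU
  rw [e1, e2, e3, e4, e5, e6, e7]

end Contraction


section Minor

open THRefutation

variable {V' V'' E' : Type*}

/-- A family of vertex sets pulled back along a vertex map: `{S | q '' S ∈ 𝓤''}`. -/
def pullFam (q : V' → V'') (𝓤'' : Set (Set V'')) : Set (Set V') := {S | q '' S ∈ 𝓤''}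

/-- Pulling back preserves up-sets. -/
lemma isUpperSet_pullFam (q : V' → V'') {𝓤'' : Set (Set V'')} (h : IsUpperSet 𝓤'') :
    IsUpperSet (pullFam q 𝓤'') :=
  fun _ _ hle hS => h (Set.image_mono hle) hS

/-- For a surjective `q`, lifting the pull-back gives the family back. -/
lemma liftFamF_pullFam {q : V' → V''} (hq : Function.Surjective q) (𝓤'' : Set (Set V'')) :
    liftFamF q (pullFam q 𝓤'') = 𝓤'' := by
  ext S''; simp [liftFamF, pullFam, Set.image_preimage_eq S'' hq]

/-- The weights of the minor witness: `1` on the contracted edges, the weights of `THRefutation` on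
the image of `G₆`, `0` elsewhere. -/
noncomputable def minorWeights (ωF : Config E') (ιE : Fin 10 ↪ E') : E' → ℚ :=
  fun e' => if ωF e' = true then 1 else extP ιE p e'

/-- The minor weights are admissible. -/
lemma isProbVec_minorWeights (ωF : Config E') (ιE : Fin 10 ↪ E') :
    IsProbVec (minorWeights ωF ιE) := by
  have h := isProbVec_extP ιE isProbVec_p
  refine ⟨fun e' => ?_, fun e' => ?_⟩ <;> unfold minorWeights <;> split_ifs
  · exact zero_le_one
  · exact h.nonneg e'
  · exact le_rfl
  · exact h.le_one e'

/-- A contracted edge is a loop of the contracted graph. -/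
lemma isDiag_push_of_mem (ends' : E' → Sym2 V') (q : V' → V'') (ωF : Config E')
    (hq : ∀ a b, q a = q b ↔ Conn ends' ωF a b) {e : E'} (he : ωF e = true) :
    (pushEnds q ends' e).IsDiag := by
  induction hab : ends' e using Sym2.ind with
  | h a b =>
    simp only [pushEnds, hab, Sym2.map_mk, Sym2.mk_isDiag_iff]
    exact (hq a b).2 (conn_of_openAdj ⟨e, he, hab⟩)

variable [Fintype E'] [DecidableEq E']

/-- **`(T_h)` fails on every finite graph containing `G₆` as a rooted minor**: contract the edges of
`ωF` (`q : V' → V''` identifies exactly the `ωF`-connected vertices), embed `G₆` in the result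
(`ιV`, `ιE` with `pushEnds q ends' (ιE e) = (ends e).map ιV`); with the weights `minorWeights` (`1` on
the contracted edges, those of `THRefutation` on the image, `0` elsewhere), any root `s'` over `ιV 0`
and hit vertex `x'` over `ιV 1`, and the single-vertex families lifted along `ιV` and pulled back
along `q`, the form is negative. -/
theorem tForm_minor_neg (ends' : E' → Sym2 V') (q : V' → V'') (hsurj : Function.Surjective q)
    (ωF : Config E') (hq : ∀ a b, q a = q b ↔ Conn ends' ωF a b) (ιV : Fin 7 ↪ V'')
    (ιE : Fin 10 ↪ E') (hE : ∀ e, pushEnds q ends' (ιE e) = (ends e).map ιV) (s' x' : V')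
    (hs : q s' = ιV 0) (hx : q x' = ιV 1) :
    tForm ends' (minorWeights ωF ιE) s' x'
      (pullFam q (liftFam ιV {T : Set (Fin 7) | (5 : Fin 7) ∈ T}))
      (pullFam q (liftFam ιV {T : Set (Fin 7) | (6 : Fin 7) ∈ T})) < 0 := by
  have hp : ∀ e, ωF e = true → minorWeights ωF ιE e = 1 := fun e he => by simp [minorWeights, he]
  rw [← tForm_contract ends' q ωF hq hp, hs, hx, liftFamF_pullFam hsurj, liftFamF_pullFam hsurj,
    tForm_eq_of_loops (pushEnds q ends') (minorWeights ωF ιE) (extP ιE p) (fun e hl => ?_),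
    tForm_extend ιV ιE ends (pushEnds q ends') hE]
  · exact tForm_witness_neg
  · unfold minorWeights
    split_ifs with he
    · exact absurd (isDiag_push_of_mem ends' q ωF hq he) hl
    · rfl

/-- The minor statement in the explicit shape of `(T_h)`. -/
theorem not_t_of_minor (ends' : E' → Sym2 V') (q : V' → V'') (hsurj : Function.Surjective q)
    (ωF : Config E') (hq : ∀ a b, q a = q b ↔ Conn ends' ωF a b) (ιV : Fin 7 ↪ V'')
    (ιE : Fin 10 ↪ E') (hE : ∀ e, pushEnds q ends' (ιE e) = (ends e).map ιV) (s' x' : V')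
    (hs : q s' = ιV 0) (hx : q x' = ιV 1) :
    ∃ (p' : E' → ℚ) (𝓤 𝓥 : Set (Set V')), IsProbVec p' ∧ IsUpperSet 𝓤 ∧ IsUpperSet 𝓥 ∧
      prob p' (clusterInEvent ends' s' {T : Set V' | x' ∈ T} ∩ clusterInEvent ends' s' 𝓤 ∩
          clusterInEvent ends' s' 𝓥)
        + prob p' (clusterInEvent ends' s' {T : Set V' | x' ∈ T}) *
          prob p' (clusterInEvent ends' s' 𝓤 ∩ clusterInEvent ends' s' 𝓥) <
      prob p' (clusterInEvent ends' s' {T : Set V' | x' ∈ T} ∩ clusterInEvent ends' s' 𝓤) *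
          prob p' (clusterInEvent ends' s' 𝓥)
        + prob p' (clusterInEvent ends' s' {T : Set V' | x' ∈ T} ∩ clusterInEvent ends' s' 𝓥) *
          prob p' (clusterInEvent ends' s' 𝓤) := by
  refine ⟨minorWeights ωF ιE, pullFam q (liftFam ιV {T : Set (Fin 7) | (5 : Fin 7) ∈ T}),
    pullFam q (liftFam ιV {T : Set (Fin 7) | (6 : Fin 7) ∈ T}), isProbVec_minorWeights ωF ιE,
    isUpperSet_pullFam q (isUpperSet_liftFam ιV (fun _ _ hle hT => hle hT)),
    isUpperSet_pullFam q (isUpperSet_liftFam ιV (fun _ _ hle hT => hle hT)), ?_⟩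
  have h := tForm_minor_neg ends' q hsurj ωF hq ιV ιE hE s' x' hs hx
  unfold tForm at h
  linarith

end Minor

end THMinor

end Summit.Ventures.PercRepro2
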